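import Literature.Analysis.FluidPDE.PlanarBiotSavartDivFree
import Literature.Analysis.FluidPDE.PlanarPolarCoords
import Mathlib.Analysis.Calculus.ContDiff.Convolution
import HarnessLib

/-!
# The Biot–Savart velocity of a `C¹_c` planar vorticity: `v ∈ C¹`, `div v = 0`, `curl v = w`

Analysis/FluidPDE file (all results proved, no definitions, no named facts). For the planar
Biot–Savart law `v = K_{2D} ∗ w`, `K_{2D}(z) = z^⊥/(2π|z|²)` (`biotSavart2D`,
`biotSavartKernel2D` of `GaussianVortexPlanar`; Gallay–Wayne 2006, (1.3)) and a vorticity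
`w ∈ C^n_c(ℝ²)`, `n ≥ 1`:

* `biotSavart2D_eq_convolution` — `K_{2D} ∗ w` is Mathlib's convolution `w ⋆[lsmul] K_{2D}`
  of the compactly supported `w` with the locally integrable kernel
  (`locallyIntegrable_biotSavartKernel2D`), hence `v ∈ C^n` (`contDiff_biotSavart2D`) with
  `Dv(x)[h] = (K_{2D} ∗ D_h w)(x)` (`fderiv_biotSavart2D_apply`: derivatives fall on `w`);
* `fderiv_biotSavart2D_apply_apply_eq_lim` — the partial derivatives through the smooth
  regularisation `K_ε(z) = z^⊥/(2π(|z|² + ε²))` of `PlanarBiotSavartDivFree`: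
  `∂ᵢvⱼ(x) = lim_{ε→0} ∫ w(y) (∂ᵢK_{ε,j})(x − y) dy` (dominated convergence `K_ε → K_{2D}`,
  `|K_ε| ≤ |K_{2D}|`, then one integration by parts moving `∂ᵢ` from `w` to `K_ε`);
* `div_biotSavart2D_eq_zero` — **`∂₀v₀ + ∂₁v₁ = 0` pointwise** (`div K_ε = 0` exactly);
* `curl_biotSavart2D_eq` — **`∂₀v₁ − ∂₁v₀ = w` pointwise**: `curl K_ε = ρ_ε`,
  `ρ_ε(z) = ε²/(π(|z|² + ε²)²)`, an approximate identity (`∫ ρ₁ = 1` by polar coordinates,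
  `∫ w(x − εu)ρ₁(u) du → w(x)` by dominated convergence).

These are the classical statements "`v = K_{2D} ∗ ω` recovers the divergence-free velocity with
vorticity `ω`" (Gallay–Wayne 2006, after (1.3); Majda–Bertozzi, *Vorticity and incompressible
flow*, Prop. 2.1) for `C¹_c` vorticities, where no singular-integral theory is needed.

## References

* Th. Gallay, C. E. Wayne, *Existence and stability of asymmetric Burgers vortices*, J. Math.
  Fluid Mech. 9 (2007), (1.3). [GallayWayne2006]
* A. J. Majda, A. L. Bertozzi, *Vorticity and Incompressible Flow*, CUP (2002), §2.1,
  Prop. 2.1 (2D Biot–Savart law). [folklore]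
-/

open MeasureTheory Filter Set Metric Function
open scoped Real RealInnerProductSpace Topology InnerProductSpace Convolution

noncomputable section

namespace Literature.Analysis.FluidPDE

/-! ### The Biot–Savart law as a convolution; smoothness -/

/-- `K_{2D}` is locally integrable on `ℝ²` (`|K_{2D}(z)| = (2π|z|)⁻¹`, `|z|⁻¹ ∈ L¹_loc(ℝ²)`).
[folklore] -/
theorem locallyIntegrable_biotSavartKernel2D : LocallyIntegrable biotSavartKernel2D := by
  refine (locallyIntegrable_iff).2 fun k hk => ?_
  obtain ⟨R, hR⟩ := hk.isBounded.subset_ball 0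
  refine IntegrableOn.mono_set ?_ hR
  refine Integrable.mono' ((integrableOn_inv_norm_ball R).const_mul (2 * Real.pi)⁻¹)
    measurable_biotSavartKernel2D.aestronglyMeasurable.restrict
    (Eventually.of_forall fun z => ?_)
  rw [norm_biotSavartKernel2D]

/-- **`K_{2D} ∗ w = w ⋆ K_{2D}`**: the tree's Biot–Savart velocity is Mathlib's convolution of the
scalar density with the vector kernel through scalar multiplication. [folklore] -/
theorem biotSavart2D_eq_convolution (w : EuclideanSpace ℝ (Fin 2) → ℝ) :
    biotSavart2D w = (w ⋆[ContinuousLinearMap.lsmul ℝ ℝ, volume] biotSavartKernel2D) := by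
  funext x
  rw [convolution_def]
  rfl

/-- **`v = K_{2D} ∗ w ∈ C^n` for `w ∈ C^n_c(ℝ²)`** (differentiate under the integral on the
compactly supported factor). [folklore] -/
theorem contDiff_biotSavart2D {w : EuclideanSpace ℝ (Fin 2) → ℝ} {n : ℕ∞} (hw : ContDiff ℝ n w)
    (hwc : HasCompactSupport w) : ContDiff ℝ n (biotSavart2D w) := by
  rw [biotSavart2D_eq_convolution]
  exact hwc.contDiff_convolution_left _ hw locallyIntegrable_biotSavartKernel2D

/-- The derivative of `K_{2D} ∗ w` as a convolution (Mathlib's `precompL` form). [folklore] -/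
theorem hasFDerivAt_biotSavart2D {w : EuclideanSpace ℝ (Fin 2) → ℝ} (hw : ContDiff ℝ 1 w)
    (hwc : HasCompactSupport w) (x : EuclideanSpace ℝ (Fin 2)) :
    HasFDerivAt (biotSavart2D w)
      ((fderiv ℝ w ⋆[(ContinuousLinearMap.lsmul ℝ ℝ).precompL (EuclideanSpace ℝ (Fin 2)), volume]
        biotSavartKernel2D) x) x := by
  rw [biotSavart2D_eq_convolution]
  exact hwc.hasFDerivAt_convolution_left _ hw locallyIntegrable_biotSavartKernel2D x

/-- **`Dv(x)[h] = (K_{2D} ∗ (D_h w))(x)`**: the derivative of the Biot–Savart velocity of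
`w ∈ C¹_c` in the direction `h` is the Biot–Savart velocity of the directional derivative
`y ↦ Dw(y)[h]`. [folklore] -/
theorem fderiv_biotSavart2D_apply {w : EuclideanSpace ℝ (Fin 2) → ℝ} (hw : ContDiff ℝ 1 w)
    (hwc : HasCompactSupport w) (x h : EuclideanSpace ℝ (Fin 2)) :
    fderiv ℝ (biotSavart2D w) x h = biotSavart2D (fun y => fderiv ℝ w y h) x := by
  rw [(hasFDerivAt_biotSavart2D hw hwc x).fderiv, convolution_def]
  have hint : Integrable (fun t => ((ContinuousLinearMap.lsmul ℝ ℝ).precompL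
      (EuclideanSpace ℝ (Fin 2))) (fderiv ℝ w t) (biotSavartKernel2D (x - t))) volume :=
    ((hwc.fderiv ℝ).convolutionExists_left _ (hw.continuous_fderiv one_ne_zero)
      locallyIntegrable_biotSavartKernel2D x).integrable
  rw [ContinuousLinearMap.integral_apply hint h]
  rfl

/-! ### Components of the Biot–Savart integral -/

/-- The `j`-th component of `(K_{2D} ∗ g)(x)` is the scalar integral `∫ g(y) K_{2D}(x − y)ⱼ dy`
(when the Biot–Savart integral converges absolutely). [folklore] -/
theorem biotSavart2D_apply_eq_integral {g : EuclideanSpace ℝ (Fin 2) → ℝ}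
    {x : EuclideanSpace ℝ (Fin 2)}
    (hg : Integrable fun y => g y • biotSavartKernel2D (x - y)) (j : Fin 2) :
    biotSavart2D g x j = ∫ y, g y * biotSavartKernel2D (x - y) j := by
  unfold biotSavart2D
  have h := ((EuclideanSpace.proj (𝕜 := ℝ) j).integral_comp_comm hg).symm
  simpa using h

/-- A continuous compactly supported density is bounded and integrable, so its Biot–Savart
integrals converge absolutely at every point. (Private copy: the same statement exists in a
Summits Theorems file, `…ParityToolsAux.parity_integrable_smul_biotSavartKernel2D`, which a
Literature file cannot import.) [folklore] -/
private theorem integrable_smul_biotSavartKernel2D_of_hasCompactSupport {g : EuclideanSpace ℝ (Fin 2) → ℝ}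
    (hg : Continuous g) (hgc : HasCompactSupport g) (x : EuclideanSpace ℝ (Fin 2)) :
    Integrable fun y => g y • biotSavartKernel2D (x - y) := by
  obtain ⟨M, hM⟩ := hg.bounded_above_of_compact_support hgc
  exact integrable_smul_biotSavartKernel2D (hg.integrable_of_hasCompactSupport hgc)
    (fun y => (Real.norm_eq_abs _).symm.le.trans (hM y)) x

/-! ### The partial derivatives through the regularised kernel `K_ε` -/

/-- **Dominated convergence `K_ε → K_{2D}` inside the Biot–Savart integral**: for a continuous
compactly supported density `g` and `ε = 1/(k+1) → 0`,
`∫ g(y) K_ε(x − y)ⱼ dy → ∫ g(y) K_{2D}(x − y)ⱼ dy` (`|K_ε| ≤ |K_{2D}|`, `|g||K_{2D}(x−·)| ∈ L¹`).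
[folklore] -/
theorem tendsto_integral_mul_regKernel_apply {g : EuclideanSpace ℝ (Fin 2) → ℝ} (hg : Continuous g)
    (hgc : HasCompactSupport g) (x : EuclideanSpace ℝ (Fin 2)) (j : Fin 2) :
    Tendsto (fun k : ℕ => ∫ y, g y *
        ((2 * Real.pi * (‖x - y‖ ^ 2 + (((k : ℝ) + 1)⁻¹) ^ 2))⁻¹ • perp (x - y)) j)
      atTop (𝓝 (∫ y, g y * biotSavartKernel2D (x - y) j)) := by
  have hεk : ∀ k : ℕ, (0 : ℝ) < ((k : ℝ) + 1)⁻¹ := fun k => by positivity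
  have hdom := (integrable_smul_biotSavartKernel2D_of_hasCompactSupport hg hgc x).norm
  refine tendsto_integral_of_dominated_convergence (fun y => ‖g y • biotSavartKernel2D (x - y)‖)
    (fun k => ?_) hdom (fun k => Eventually.of_forall fun y => ?_)
    (Eventually.of_forall fun y => ?_)
  · -- measurability: the integrand is continuous in `y`
    have hc : Continuous fun y : EuclideanSpace ℝ (Fin 2) =>
        (2 * Real.pi * (‖x - y‖ ^ 2 + (((k : ℝ) + 1)⁻¹) ^ 2))⁻¹ • perp (x - y) :=
      (((contDiff_regFactor (hεk k)).continuous).smul continuous_perp).comp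
        (continuous_const.sub continuous_id)
    exact (hg.mul ((EuclideanSpace.proj (𝕜 := ℝ) j).continuous.comp hc)).aestronglyMeasurable
  · rw [norm_mul, norm_smul]
    refine mul_le_mul_of_nonneg_left ?_ (norm_nonneg _)
    exact (PiLp.norm_apply_le _ j).trans (norm_regKernel_le (hεk k) (x - y))
  · refine Tendsto.mul tendsto_const_nhds ?_
    set z := x - y with hz
    have hF : Tendsto (fun k : ℕ => (2 * Real.pi * (‖z‖ ^ 2 + (((k : ℝ) + 1)⁻¹) ^ 2))⁻¹ • perp z)
        atTop (𝓝 (biotSavartKernel2D z)) := by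
      rcases eq_or_ne z 0 with h0 | h0
      · have hp : perp (0 : EuclideanSpace ℝ (Fin 2)) = 0 := by ext i; fin_cases i <;> simp
        rw [h0]
        simp only [hp, smul_zero, biotSavartKernel2D_zero]
        exact tendsto_const_nhds
      · have h1 : Tendsto (fun k : ℕ => ((k : ℝ) + 1)⁻¹) atTop (𝓝 0) := by
          simpa [one_div] using tendsto_one_div_add_atTop_nhds_zero_nat (𝕜 := ℝ)
        have h2 : Tendsto (fun k : ℕ => (2 * Real.pi * (‖z‖ ^ 2 + (((k : ℝ) + 1)⁻¹) ^ 2))⁻¹) atTop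
            (𝓝 ((2 * Real.pi * ‖z‖ ^ 2)⁻¹)) := by
          have := ((h1.pow 2).const_add (‖z‖ ^ 2)).const_mul (2 * Real.pi)
          rw [zero_pow two_ne_zero, add_zero] at this
          have hzn : ‖z‖ ^ 2 ≠ 0 := by positivity
          exact this.inv₀ (by positivity)
        simp only [biotSavartKernel2D]
        exact h2.smul_const _
    exact ((EuclideanSpace.proj (𝕜 := ℝ) j).continuous.tendsto _).comp hF

/-- **Moving a derivative from the density onto a `C¹` kernel**: for `w ∈ C¹_c(ℝ²)` and a `C¹`
scalar kernel `κ`, `∫ ∂ᵢw(y) κ(x − y) dy = ∫ w(y) (∂ᵢκ)(x − y) dy` (integration by parts in `y`;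
the two minus signs — from the integration by parts and from `∂_{yᵢ}[κ(x − y)] = −(∂ᵢκ)(x − y)` —
cancel). [folklore] -/
theorem integral_fderiv_mul_comp_sub_eq {w κ : EuclideanSpace ℝ (Fin 2) → ℝ} (hw : ContDiff ℝ 1 w)
    (hwc : HasCompactSupport w) (hκ : ContDiff ℝ 1 κ) (x v : EuclideanSpace ℝ (Fin 2)) :
    ∫ y, fderiv ℝ w y v * κ (x - y) = ∫ y, w y * fderiv ℝ κ (x - y) v := by
  set g : EuclideanSpace ℝ (Fin 2) → ℝ := fun y => κ (x - y) with hg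
  have hgd : ∀ y, HasFDerivAt g ((fderiv ℝ κ (x - y)).comp
      ((0 : EuclideanSpace ℝ (Fin 2) →L[ℝ] EuclideanSpace ℝ (Fin 2)) -
        ContinuousLinearMap.id ℝ (EuclideanSpace ℝ (Fin 2)))) y := fun y =>
    ((hκ.differentiable one_ne_zero) (x - y)).hasFDerivAt.comp y
      ((hasFDerivAt_const x y).sub (hasFDerivAt_id y))
  have hgd' : ∀ y, fderiv ℝ g y v = -fderiv ℝ κ (x - y) v := fun y => by
    rw [(hgd y).fderiv]
    simp
  have hgc1 : ContDiff ℝ 1 g := hκ.comp (contDiff_const.sub contDiff_id)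
  have hgcont : Continuous g := hgc1.continuous
  have hg1cont : Continuous fun y => fderiv ℝ g y v :=
    (hgc1.continuous_fderiv one_ne_zero).clm_apply continuous_const
  have hw1cont : Continuous fun y => fderiv ℝ w y v :=
    (hw.continuous_fderiv one_ne_zero).clm_apply continuous_const
  have hw1c : HasCompactSupport fun y => fderiv ℝ w y v := hwc.fderiv_apply (𝕜 := ℝ) v
  have i1 : Integrable (fun y => fderiv ℝ g y v * w y) :=
    (hg1cont.mul hw.continuous).integrable_of_hasCompactSupport hwc.mul_left
  have i2 : Integrable (fun y => g y * fderiv ℝ w y v) :=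
    (hgcont.mul hw1cont).integrable_of_hasCompactSupport hw1c.mul_left
  have i3 : Integrable (fun y => g y * w y) :=
    (hgcont.mul hw.continuous).integrable_of_hasCompactSupport hwc.mul_left
  have ibp := integral_mul_fderiv_eq_neg_fderiv_mul_of_integrable i1 i2 i3
    (fun y _ => (hgd y).differentiableAt) (fun y _ => (hw.differentiable one_ne_zero) y)
  calc ∫ y, fderiv ℝ w y v * κ (x - y) = ∫ y, g y * fderiv ℝ w y v :=
        integral_congr_ae (Eventually.of_forall fun y => by simp only [hg]; ring)
    _ = -∫ y, fderiv ℝ g y v * w y := ibp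
    _ = ∫ y, w y * fderiv ℝ κ (x - y) v := by
        rw [← integral_neg]
        exact integral_congr_ae (Eventually.of_forall fun y => by
          simp only [hgd' y]; ring)

/-- The two components of the regularised kernel as scalar `C¹` functions (notation of
`PlanarBiotSavartDivFree`): `(K_ε)₀(z) = −c_ε(z) z₁`, `(K_ε)₁(z) = c_ε(z) z₀`,
`c_ε(z) = (2π(|z|² + ε²))⁻¹`; this picks the component. [folklore] -/
theorem regKernel_apply_zero (ε : ℝ) (z : EuclideanSpace ℝ (Fin 2)) :
    ((2 * Real.pi * (‖z‖ ^ 2 + ε ^ 2))⁻¹ • perp z) 0 =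
      -((2 * Real.pi * (‖z‖ ^ 2 + ε ^ 2))⁻¹ * z 1) :=
  (regKernel_apply (ε := ε) z).1

/-- The component `(K_ε)₁(z) = c_ε(z) z₀`. [folklore] -/
theorem regKernel_apply_one (ε : ℝ) (z : EuclideanSpace ℝ (Fin 2)) :
    ((2 * Real.pi * (‖z‖ ^ 2 + ε ^ 2))⁻¹ • perp z) 1 = (2 * Real.pi * (‖z‖ ^ 2 + ε ^ 2))⁻¹ * z 0 :=
  (regKernel_apply (ε := ε) z).2

/-- **`∂ᵢvⱼ(x) = lim_{ε→0} ∫ w(y) (∂ᵢK_{ε,j})(x − y) dy`** for `v = K_{2D} ∗ w`, `w ∈ C¹_c(ℝ²)`: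
the partial derivatives of the Biot–Savart velocity through the regularised kernel
(`Dv[eᵢ] = K_{2D} ∗ ∂ᵢw`, dominated convergence `K_ε → K_{2D}`, then the derivative is moved onto
the smooth `K_ε`). Component `j = 0`. [folklore] -/
theorem tendsto_integral_mul_fderiv_regKernel_fst {w : EuclideanSpace ℝ (Fin 2) → ℝ}
    (hw : ContDiff ℝ 1 w) (hwc : HasCompactSupport w) (x v : EuclideanSpace ℝ (Fin 2)) :
    Tendsto (fun k : ℕ => ∫ y, w y *
        fderiv ℝ (fun z => -((2 * Real.pi * (‖z‖ ^ 2 + (((k : ℝ) + 1)⁻¹) ^ 2))⁻¹ * z 1))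
          (x - y) v)
      atTop (𝓝 (fderiv ℝ (biotSavart2D w) x v 0)) := by
  have hεk : ∀ k : ℕ, (0 : ℝ) < ((k : ℝ) + 1)⁻¹ := fun k => by positivity
  have hg : Continuous fun y => fderiv ℝ w y v :=
    (hw.continuous_fderiv one_ne_zero).clm_apply continuous_const
  have hgc : HasCompactSupport fun y => fderiv ℝ w y v := hwc.fderiv_apply (𝕜 := ℝ) v
  rw [fderiv_biotSavart2D_apply hw hwc,
    biotSavart2D_apply_eq_integral
      (integrable_smul_biotSavartKernel2D_of_hasCompactSupport hg hgc x)]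
  refine (tendsto_integral_mul_regKernel_apply hg hgc x 0).congr fun k => ?_
  simp_rw [regKernel_apply_zero]
  exact integral_fderiv_mul_comp_sub_eq hw hwc (contDiff_regKernel_fst (hεk k)) x v

/-- As `tendsto_integral_mul_fderiv_regKernel_fst`, component `j = 1`. [folklore] -/
theorem tendsto_integral_mul_fderiv_regKernel_snd {w : EuclideanSpace ℝ (Fin 2) → ℝ}
    (hw : ContDiff ℝ 1 w) (hwc : HasCompactSupport w) (x v : EuclideanSpace ℝ (Fin 2)) :
    Tendsto (fun k : ℕ => ∫ y, w y *
        fderiv ℝ (fun z => (2 * Real.pi * (‖z‖ ^ 2 + (((k : ℝ) + 1)⁻¹) ^ 2))⁻¹ * z 0)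
          (x - y) v)
      atTop (𝓝 (fderiv ℝ (biotSavart2D w) x v 1)) := by
  have hεk : ∀ k : ℕ, (0 : ℝ) < ((k : ℝ) + 1)⁻¹ := fun k => by positivity
  have hg : Continuous fun y => fderiv ℝ w y v :=
    (hw.continuous_fderiv one_ne_zero).clm_apply continuous_const
  have hgc : HasCompactSupport fun y => fderiv ℝ w y v := hwc.fderiv_apply (𝕜 := ℝ) v
  rw [fderiv_biotSavart2D_apply hw hwc,
    biotSavart2D_apply_eq_integral
      (integrable_smul_biotSavartKernel2D_of_hasCompactSupport hg hgc x)]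
  refine (tendsto_integral_mul_regKernel_apply hg hgc x 1).congr fun k => ?_
  simp_rw [regKernel_apply_one]
  exact integral_fderiv_mul_comp_sub_eq hw hwc (contDiff_regKernel_snd (hεk k)) x v

/-! ### `div v = 0` pointwise -/

/-- **The Biot–Savart velocity of a `C¹_c` vorticity is divergence-free pointwise**:
`∂₀v₀(x) + ∂₁v₁(x) = 0` for `v = K_{2D} ∗ w`, at every `x` (the regularised kernels are
exactly divergence-free, `fderiv_regKernel_fst_add_snd`). [cite: GallayWayne2006, (1.3)] -/
theorem div_biotSavart2D_eq_zero {w : EuclideanSpace ℝ (Fin 2) → ℝ} (hw : ContDiff ℝ 1 w)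
    (hwc : HasCompactSupport w) (x : EuclideanSpace ℝ (Fin 2)) :
    fderiv ℝ (biotSavart2D w) x (EuclideanSpace.single 0 1) 0 +
      fderiv ℝ (biotSavart2D w) x (EuclideanSpace.single 1 1) 1 = 0 := by
  have hεk : ∀ k : ℕ, (0 : ℝ) < ((k : ℝ) + 1)⁻¹ := fun k => by positivity
  have h0 := tendsto_integral_mul_fderiv_regKernel_fst hw hwc x (EuclideanSpace.single 0 1)
  have h1 := tendsto_integral_mul_fderiv_regKernel_snd hw hwc x (EuclideanSpace.single 1 1)
  have hsum := h0.add h1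
  -- the approximating sequence is identically zero
  have hzero : ∀ k : ℕ, (∫ y, w y *
      fderiv ℝ (fun z => -((2 * Real.pi * (‖z‖ ^ 2 + (((k : ℝ) + 1)⁻¹) ^ 2))⁻¹ * z 1))
        (x - y) (EuclideanSpace.single 0 1)) +
      (∫ y, w y *
      fderiv ℝ (fun z => (2 * Real.pi * (‖z‖ ^ 2 + (((k : ℝ) + 1)⁻¹) ^ 2))⁻¹ * z 0)
        (x - y) (EuclideanSpace.single 1 1)) = 0 := by
    intro k
    have hk0 := contDiff_regKernel_fst (hεk k)
    have hk1 := contDiff_regKernel_snd (hεk k)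
    have hc0 : Continuous fun y : EuclideanSpace ℝ (Fin 2) => fderiv ℝ
        (fun z => -((2 * Real.pi * (‖z‖ ^ 2 + (((k : ℝ) + 1)⁻¹) ^ 2))⁻¹ * z 1))
        (x - y) (EuclideanSpace.single 0 1) :=
      ((hk0.continuous_fderiv one_ne_zero).clm_apply continuous_const).comp
        (continuous_const.sub continuous_id)
    have hc1 : Continuous fun y : EuclideanSpace ℝ (Fin 2) => fderiv ℝ
        (fun z => (2 * Real.pi * (‖z‖ ^ 2 + (((k : ℝ) + 1)⁻¹) ^ 2))⁻¹ * z 0)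
        (x - y) (EuclideanSpace.single 1 1) :=
      ((hk1.continuous_fderiv one_ne_zero).clm_apply continuous_const).comp
        (continuous_const.sub continuous_id)
    have i0 : Integrable (fun y => w y * fderiv ℝ
        (fun z => -((2 * Real.pi * (‖z‖ ^ 2 + (((k : ℝ) + 1)⁻¹) ^ 2))⁻¹ * z 1))
        (x - y) (EuclideanSpace.single 0 1)) :=
      (hw.continuous.mul hc0).integrable_of_hasCompactSupport hwc.mul_right
    have i1 : Integrable (fun y => w y * fderiv ℝ
        (fun z => (2 * Real.pi * (‖z‖ ^ 2 + (((k : ℝ) + 1)⁻¹) ^ 2))⁻¹ * z 0)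
        (x - y) (EuclideanSpace.single 1 1)) :=
      (hw.continuous.mul hc1).integrable_of_hasCompactSupport hwc.mul_right
    rw [← integral_add i0 i1]
    refine integral_eq_zero_of_ae (Eventually.of_forall fun y => ?_)
    simp only [Pi.zero_apply]
    rw [← mul_add, fderiv_regKernel_fst_add_snd (hεk k) (x - y), mul_zero]
  simp_rw [hzero] at hsum
  exact tendsto_nhds_unique hsum tendsto_const_nhds

/-! ### `curl K_ε = ρ_ε`, an approximate identity -/

section Curl

variable {ε : ℝ} (hε : 0 < ε)
include hε

/-- `∂₀(K_ε)₁(z) = κ(z) z₀² + c_ε(z)` with `κ = Dc_ε/⟪z,·⟫ = −4π c_ε²`. [folklore] -/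
theorem fderiv_regKernel_one_fst (z : EuclideanSpace ℝ (Fin 2)) :
    fderiv ℝ (fun w => (2 * Real.pi * (‖w‖ ^ 2 + ε ^ 2))⁻¹ * w 0) z
        (EuclideanSpace.single 0 1) =
      -((2 * Real.pi * (‖z‖ ^ 2 + ε ^ 2)) ^ 2)⁻¹ * (2 * Real.pi) * 2 * z 0 * z 0 +
        (2 * Real.pi * (‖z‖ ^ 2 + ε ^ 2))⁻¹ := by
  have hc := hasFDerivAt_regFactor hε z
  have h0 : HasFDerivAt (fun w : EuclideanSpace ℝ (Fin 2) => w 0)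
      (EuclideanSpace.proj 0 : EuclideanSpace ℝ (Fin 2) →L[ℝ] ℝ) z :=
    (EuclideanSpace.proj (0 : Fin 2) : EuclideanSpace ℝ (Fin 2) →L[ℝ] ℝ).hasFDerivAt
  rw [(hc.fun_mul h0).fderiv]
  simp [EuclideanSpace.inner_single_right]
  ring

/-- `∂₁(K_ε)₀(z) = −(κ(z) z₁² + c_ε(z))`. [folklore] -/
theorem fderiv_regKernel_zero_snd (z : EuclideanSpace ℝ (Fin 2)) :
    fderiv ℝ (fun w => -((2 * Real.pi * (‖w‖ ^ 2 + ε ^ 2))⁻¹ * w 1)) z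
        (EuclideanSpace.single 1 1) =
      -(-((2 * Real.pi * (‖z‖ ^ 2 + ε ^ 2)) ^ 2)⁻¹ * (2 * Real.pi) * 2 * z 1 * z 1 +
        (2 * Real.pi * (‖z‖ ^ 2 + ε ^ 2))⁻¹) := by
  have hc := hasFDerivAt_regFactor hε z
  have h1 : HasFDerivAt (fun w : EuclideanSpace ℝ (Fin 2) => w 1)
      (EuclideanSpace.proj 1 : EuclideanSpace ℝ (Fin 2) →L[ℝ] ℝ) z :=
    (EuclideanSpace.proj (1 : Fin 2) : EuclideanSpace ℝ (Fin 2) →L[ℝ] ℝ).hasFDerivAt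
  rw [((hc.fun_mul h1).fun_neg).fderiv]
  simp [EuclideanSpace.inner_single_right]
  ring

/-- **`curl K_ε = ρ_ε`**: `∂₀(K_ε)₁ − ∂₁(K_ε)₀ = ε²/(π(|z|² + ε²)²)` (`= ΔN_ε` for
`N_ε = (4π)⁻¹ log(|z|² + ε²)`, of which `K_ε = ∇^⊥N_ε`). [folklore] -/
theorem curl_regKernel (z : EuclideanSpace ℝ (Fin 2)) :
    fderiv ℝ (fun w => (2 * Real.pi * (‖w‖ ^ 2 + ε ^ 2))⁻¹ * w 0) z
        (EuclideanSpace.single 0 1) -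
      fderiv ℝ (fun w => -((2 * Real.pi * (‖w‖ ^ 2 + ε ^ 2))⁻¹ * w 1)) z
        (EuclideanSpace.single 1 1) =
      ε ^ 2 / (Real.pi * (‖z‖ ^ 2 + ε ^ 2) ^ 2) := by
  rw [fderiv_regKernel_one_fst hε, fderiv_regKernel_zero_snd hε]
  have hn : ‖z‖ ^ 2 = z 0 * z 0 + z 1 * z 1 := by
    rw [EuclideanSpace.norm_sq_eq, Fin.sum_univ_two, Real.norm_eq_abs, Real.norm_eq_abs, sq_abs,
      sq_abs]
    ring
  have hs : 0 < ‖z‖ ^ 2 + ε ^ 2 := normSq_add_sq_pos hε z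
  have hπ : Real.pi ≠ 0 := Real.pi_pos.ne'
  rw [hn] at hs ⊢
  field_simp
  ring

end Curl

/-- The Cauchy-type kernel `ρ₁(u) = (π(|u|² + 1)²)⁻¹` is integrable on `ℝ²` (`O(|u|⁻⁴)`).
[folklore] -/
theorem integrable_cauchyKernel2D :
    Integrable fun u : EuclideanSpace ℝ (Fin 2) => (Real.pi * (‖u‖ ^ 2 + 1) ^ 2)⁻¹ := by
  have h4 : ((Module.finrank ℝ (EuclideanSpace ℝ (Fin 2)) : ℕ) : ℝ) < 4 := by
    rw [finrank_euclideanSpace_fin]; norm_num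
  have hI := (integrable_rpow_neg_one_add_norm_sq
    (μ := (volume : Measure (EuclideanSpace ℝ (Fin 2)))) h4).const_mul (Real.pi)⁻¹
  refine hI.congr (Eventually.of_forall fun u => ?_)
  have h0 : 0 ≤ (1 : ℝ) + ‖u‖ ^ 2 := by positivity
  dsimp only
  rw [show (-4 / 2 : ℝ) = -(2 : ℝ) by norm_num, Real.rpow_neg h0, Real.rpow_two, mul_inv, add_comm]

/-- **`∫_{ℝ²} (π(|u|² + 1)²)⁻¹ du = 1`** (polar coordinates: `∫_0^∞ 2r/(r² + 1)² dr = 1`).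
[folklore] -/
theorem integral_cauchyKernel2D :
    ∫ u : EuclideanSpace ℝ (Fin 2), (Real.pi * (‖u‖ ^ 2 + 1) ^ 2)⁻¹ = 1 := by
  rw [integral_eq_integral_circlePt integrable_cauchyKernel2D]
  have hπ : 0 < Real.pi := Real.pi_pos
  have hinner : ∀ r ∈ Ioi (0 : ℝ), (∫ θ in Ioc (-π) π,
      r • (Real.pi * (‖circlePt r θ‖ ^ 2 + 1) ^ 2)⁻¹) = 2 * r / (r ^ 2 + 1) ^ 2 := by
    intro r hr
    simp_rw [norm_circlePt, sq_abs]
    rw [setIntegral_const, smul_eq_mul, smul_eq_mul, Real.volume_real_Ioc_of_le (by linarith)]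
    field_simp
    ring
  rw [setIntegral_congr_fun measurableSet_Ioi hinner]
  have hderiv : ∀ r ∈ Ici (0 : ℝ), HasDerivAt (fun r : ℝ => -(r ^ 2 + 1)⁻¹)
      (2 * r / (r ^ 2 + 1) ^ 2) r := by
    intro r _
    have h1 : HasDerivAt (fun r : ℝ => r ^ 2 + 1) (2 * r) r := by
      simpa using (hasDerivAt_pow 2 r).add_const 1
    have hne : r ^ 2 + 1 ≠ 0 := by positivity
    refine ((h1.inv hne).neg).congr_deriv ?_
    rw [neg_div, neg_neg]
  have hlim : Tendsto (fun r : ℝ => -(r ^ 2 + 1)⁻¹) atTop (𝓝 0) := by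
    rw [show (0 : ℝ) = -0 by simp]
    refine Tendsto.neg ?_
    refine tendsto_inv_atTop_zero.comp ?_
    exact tendsto_atTop_add_const_right _ _ (tendsto_pow_atTop two_ne_zero)
  rw [integral_Ioi_of_hasDerivAt_of_nonneg' hderiv (fun r hr => by
    have : (0 : ℝ) < r := hr; positivity) hlim]
  norm_num

/-- **Approximate identity.** For a continuous bounded `w` and `ε = 1/(k+1) → 0`,
`∫ w(y) ρ_ε(x − y) dy → w(x)`, `ρ_ε(z) = ε²/(π(|z|² + ε²)²) = ε⁻²ρ₁(z/ε)`: substitute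
`y = x − εu` (`∫ w(x − εu) ρ₁(u) du`) and use dominated convergence with `∫ ρ₁ = 1`. [folklore] -/
theorem tendsto_integral_mul_cauchyKernel2D {w : EuclideanSpace ℝ (Fin 2) → ℝ} (hw : Continuous w)
    {M : ℝ} (hM : ∀ y, ‖w y‖ ≤ M) (x : EuclideanSpace ℝ (Fin 2)) :
    Tendsto (fun k : ℕ => ∫ y, w y *
        ((((k : ℝ) + 1)⁻¹) ^ 2 / (Real.pi * (‖x - y‖ ^ 2 + (((k : ℝ) + 1)⁻¹) ^ 2) ^ 2)))
      atTop (𝓝 (w x)) := by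
  have hπ : 0 < Real.pi := Real.pi_pos
  -- the substitution `y = x - ε u`
  have hsub : ∀ {ε : ℝ}, 0 < ε → (∫ y, w y * (ε ^ 2 / (Real.pi * (‖x - y‖ ^ 2 + ε ^ 2) ^ 2))) =
      ∫ u, w (x - ε • u) * (Real.pi * (‖u‖ ^ 2 + 1) ^ 2)⁻¹ := by
    intro ε hε
    set f : EuclideanSpace ℝ (Fin 2) → ℝ :=
      fun z => w (x - z) * (ε ^ 2 / (Real.pi * (‖z‖ ^ 2 + ε ^ 2) ^ 2)) with hf
    have h1 : (∫ y, w y * (ε ^ 2 / (Real.pi * (‖x - y‖ ^ 2 + ε ^ 2) ^ 2))) = ∫ y, f (x - y) := by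
      refine integral_congr_ae (Eventually.of_forall fun y => ?_)
      simp only [hf, sub_sub_cancel]
    have h2 : (∫ y, f (x - y)) = ∫ z, f z := integral_sub_left_eq_self f volume x
    have h3 : (∫ u, f (ε • u)) = |(ε ^ Module.finrank ℝ (EuclideanSpace ℝ (Fin 2)))⁻¹| • ∫ z, f z :=
      Measure.integral_comp_smul volume f ε
    rw [finrank_euclideanSpace_fin, abs_of_pos (by positivity), smul_eq_mul] at h3
    have h4 : (∫ z, f z) = ε ^ 2 * ∫ u, f (ε • u) := by
      rw [h3, ← mul_assoc, mul_inv_cancel₀ (by positivity), one_mul]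
    rw [h1, h2, h4, ← integral_const_mul]
    refine integral_congr_ae (Eventually.of_forall fun u => ?_)
    simp only [hf, norm_smul, Real.norm_eq_abs, abs_of_pos hε]
    have hu : 0 < ‖u‖ ^ 2 + 1 := by positivity
    field_simp
  have hεk : ∀ k : ℕ, (0 : ℝ) < ((k : ℝ) + 1)⁻¹ := fun k => by positivity
  have heq : (fun k : ℕ => ∫ y, w y *
      ((((k : ℝ) + 1)⁻¹) ^ 2 / (Real.pi * (‖x - y‖ ^ 2 + (((k : ℝ) + 1)⁻¹) ^ 2) ^ 2))) =
      fun k : ℕ => ∫ u, w (x - ((k : ℝ) + 1)⁻¹ • u) * (Real.pi * (‖u‖ ^ 2 + 1) ^ 2)⁻¹ := by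
    funext k; exact hsub (hεk k)
  rw [heq]
  have hM0 : 0 ≤ M := (norm_nonneg _).trans (hM x)
  have hlim : Tendsto (fun k : ℕ => ∫ u, w (x - ((k : ℝ) + 1)⁻¹ • u) *
      (Real.pi * (‖u‖ ^ 2 + 1) ^ 2)⁻¹) atTop
      (𝓝 (∫ u : EuclideanSpace ℝ (Fin 2), w x * (Real.pi * (‖u‖ ^ 2 + 1) ^ 2)⁻¹)) := by
    refine tendsto_integral_of_dominated_convergence
      (fun u => M * (Real.pi * (‖u‖ ^ 2 + 1) ^ 2)⁻¹) (fun k => ?_)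
      (integrable_cauchyKernel2D.const_mul M) (fun k => Eventually.of_forall fun u => ?_)
      (Eventually.of_forall fun u => ?_)
    · have hρ : Continuous fun u : EuclideanSpace ℝ (Fin 2) => (Real.pi * (‖u‖ ^ 2 + 1) ^ 2)⁻¹ :=
        Continuous.inv₀ (by fun_prop) fun u => by positivity
      have h2 : Continuous fun u : EuclideanSpace ℝ (Fin 2) => w (x - ((k : ℝ) + 1)⁻¹ • u) :=
        hw.comp (continuous_const.sub (continuous_const_smul _))
      exact (h2.mul hρ).aestronglyMeasurable
    · have h0 : (0 : ℝ) ≤ (Real.pi * (‖u‖ ^ 2 + 1) ^ 2)⁻¹ := by positivity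
      rw [norm_mul, Real.norm_of_nonneg h0]
      exact mul_le_mul_of_nonneg_right (hM _) h0
    · refine Tendsto.mul ?_ tendsto_const_nhds
      refine (hw.tendsto x).comp ?_
      have h1 : Tendsto (fun k : ℕ => ((k : ℝ) + 1)⁻¹) atTop (𝓝 0) := by
        simpa [one_div] using tendsto_one_div_add_atTop_nhds_zero_nat (𝕜 := ℝ)
      have := (tendsto_const_nhds (x := x)).sub (h1.smul_const u)
      simpa using this
  rw [integral_const_mul, integral_cauchyKernel2D, mul_one] at hlim
  exact hlim

/-! ### `curl v = w` pointwise -/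

/-- **The Biot–Savart velocity of a `C¹_c` vorticity has that vorticity, pointwise**:
`∂₀v₁(x) − ∂₁v₀(x) = w(x)` for `v = K_{2D} ∗ w` at every `x` (Gallay–Wayne 2006, (1.3):
"`∂₁v₂ − ∂₂v₁ = ω`"): through the regularisation, `∂₀v₁ − ∂₁v₀ = lim ∫ w (curl K_ε)(x − ·) =
lim ∫ w ρ_ε(x − ·) = w(x)`. [cite: GallayWayne2006, (1.3)] -/
theorem curl_biotSavart2D_eq {w : EuclideanSpace ℝ (Fin 2) → ℝ} (hw : ContDiff ℝ 1 w)
    (hwc : HasCompactSupport w) (x : EuclideanSpace ℝ (Fin 2)) :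
    fderiv ℝ (biotSavart2D w) x (EuclideanSpace.single 0 1) 1 -
      fderiv ℝ (biotSavart2D w) x (EuclideanSpace.single 1 1) 0 = w x := by
  have hεk : ∀ k : ℕ, (0 : ℝ) < ((k : ℝ) + 1)⁻¹ := fun k => by positivity
  have hA := tendsto_integral_mul_fderiv_regKernel_snd hw hwc x (EuclideanSpace.single 0 1)
  have hB := tendsto_integral_mul_fderiv_regKernel_fst hw hwc x (EuclideanSpace.single 1 1)
  have hdiff := hA.sub hB
  obtain ⟨M, hM⟩ := hw.continuous.bounded_above_of_compact_support hwc
  have hC := tendsto_integral_mul_cauchyKernel2D hw.continuous hM x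
  -- the two approximating sequences agree
  have heq : ∀ k : ℕ, (∫ y, w y *
      fderiv ℝ (fun z => (2 * Real.pi * (‖z‖ ^ 2 + (((k : ℝ) + 1)⁻¹) ^ 2))⁻¹ * z 0)
        (x - y) (EuclideanSpace.single 0 1)) -
      (∫ y, w y *
      fderiv ℝ (fun z => -((2 * Real.pi * (‖z‖ ^ 2 + (((k : ℝ) + 1)⁻¹) ^ 2))⁻¹ * z 1))
        (x - y) (EuclideanSpace.single 1 1)) =
      ∫ y, w y * ((((k : ℝ) + 1)⁻¹) ^ 2 /
        (Real.pi * (‖x - y‖ ^ 2 + (((k : ℝ) + 1)⁻¹) ^ 2) ^ 2)) := by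
    intro k
    have hk0 := contDiff_regKernel_fst (hεk k)
    have hk1 := contDiff_regKernel_snd (hεk k)
    have hc0 : Continuous fun y : EuclideanSpace ℝ (Fin 2) => fderiv ℝ
        (fun z => -((2 * Real.pi * (‖z‖ ^ 2 + (((k : ℝ) + 1)⁻¹) ^ 2))⁻¹ * z 1))
        (x - y) (EuclideanSpace.single 1 1) :=
      ((hk0.continuous_fderiv one_ne_zero).clm_apply continuous_const).comp
        (continuous_const.sub continuous_id)
    have hc1 : Continuous fun y : EuclideanSpace ℝ (Fin 2) => fderiv ℝ
        (fun z => (2 * Real.pi * (‖z‖ ^ 2 + (((k : ℝ) + 1)⁻¹) ^ 2))⁻¹ * z 0)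
        (x - y) (EuclideanSpace.single 0 1) :=
      ((hk1.continuous_fderiv one_ne_zero).clm_apply continuous_const).comp
        (continuous_const.sub continuous_id)
    have i0 : Integrable (fun y => w y * fderiv ℝ
        (fun z => -((2 * Real.pi * (‖z‖ ^ 2 + (((k : ℝ) + 1)⁻¹) ^ 2))⁻¹ * z 1))
        (x - y) (EuclideanSpace.single 1 1)) :=
      (hw.continuous.mul hc0).integrable_of_hasCompactSupport hwc.mul_right
    have i1 : Integrable (fun y => w y * fderiv ℝ
        (fun z => (2 * Real.pi * (‖z‖ ^ 2 + (((k : ℝ) + 1)⁻¹) ^ 2))⁻¹ * z 0)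
        (x - y) (EuclideanSpace.single 0 1)) :=
      (hw.continuous.mul hc1).integrable_of_hasCompactSupport hwc.mul_right
    rw [← integral_sub i1 i0]
    refine integral_congr_ae (Eventually.of_forall fun y => ?_)
    dsimp only
    rw [← mul_sub, curl_regKernel (hεk k) (x - y)]
  simp_rw [heq] at hdiff
  exact tendsto_nhds_unique hdiff hC

end Literature.Analysis.FluidPDE
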